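import Mathlib
import Literature.Computability.AlgebraicComplexity.ArithCircuit
import Literature.Computability.AlgebraicComplexity.StandardFamilies
import Literature.Computability.AlgebraicComplexity.PermanentIrreducible
import Literature.Computability.AlgebraicComplexity.RankOneDeterminantalExpressionsProofs

/-!
# Sketch — crux-ideate stmt-ValiantsHypothesis-15046 (`DivisionGap.PerCofactorDegreeReduction`), ideator k = 2

First-lemma signatures for the two idea cards of this seat (they need not be proved here; they
must elaborate over existing declarations):

* card `prime-walk-positivizer`: `AdditiveCreationNormalForm` (the prime walk), `PositivizerCone`,
  `AutomaticPositivity`, `CheapPositivization` (= K2), and the `n = 2` NON-PRIMALITY WITNESS of the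
  permanent in the semiring `ℝ≥0[x]` (checked by `ring`);
* card `abc-tower-collapse`: `TwoTowerCollapse` (UFD valuations in `ℂ[x]/(per_n)`, tree theorem
  `permQuot_isDomain_and_ufm`), `SingleBaseTowerCollapse` (Brownawell–Masser on a curve section).

Conventions: `L = complexity` over the semiring `ℝ≥0` (the route's monotone model); divisibility by
`per_n` is read over `ℝ` after `MvPolynomial.map NNReal.toRealHom` (per is prime in `ℝ[x]`,
`perPoly_irreducible` + UFD, but NOT prime in `ℝ≥0[x]`, see `per2_not_semiring_prime_witness`).
-/

noncomputable section

open MvPolynomial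
open scoped NNReal BigOperators

namespace Summit.ValiantsHypothesis.ValiantsHypothesis.Cruxes.PerCofactorDegreeReduction.Ideator2

open Literature.Computability.AlgebraicComplexity

/-- Shorthand: the real image of a polynomial with nonnegative coefficients. -/
abbrev toR {σ : Type*} (p : MvPolynomial σ ℝ≥0) : MvPolynomial σ ℝ :=
  MvPolynomial.map NNReal.toRealHom p

/-- `per_n ∣ p` read over the field `ℝ` (cofactor allowed to be SIGNED). -/
def PerDvd (n : ℕ) (p : MvPolynomial (Fin n × Fin n) ℝ≥0) : Prop :=
  perPoly (Fin n) ℝ ∣ toR p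

/-- `per_n ∣ p` inside the semiring `ℝ≥0[x]` (cofactor NONNEGATIVE) — the divisibility the crux needs. -/
def PerDvdPos (n : ℕ) (p : MvPolynomial (Fin n × Fin n) ℝ≥0) : Prop :=
  perPoly (Fin n) ℝ≥0 ∣ p

/-! ## Card `prime-walk-positivizer` -/

/-- **First lemma (the prime walk; provable now, size M).**  `per_n` is prime in `ℝ[x]`
(`perPoly_irreducible` + `MvPolynomial` over a field is a UFD), so in a monotone circuit a PRODUCT
gate is divisible by `per_n` only if a factor is, and a weighted SUM gate with both summands divisible
passes divisibility down; walking down from the output of an optimal monotone circuit for a nonzero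
`g ∈ (per_n)` therefore ends at an ADDITIVE CREATION POINT: a gate `w₁ c₁ + w₂ c₂ ∈ (per_n)` whose two
summands are gates NOT in `(per_n)`.  Everything met on the way is a gate of the same circuit (cost
`≤ L(g)`) and degrees only drop (no cancellation over `ℝ≥0`). -/
def AdditiveCreationNormalForm : Prop :=
  ∀ (n : ℕ), 2 ≤ n → ∀ g : MvPolynomial (Fin n × Fin n) ℝ≥0, g ≠ 0 → PerDvd n g →
    ∃ (c₁ c₂ : MvPolynomial (Fin n × Fin n) ℝ≥0) (w₁ w₂ : ℝ≥0),
      complexity c₁ ≤ complexity g ∧ complexity c₂ ≤ complexity g ∧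
      complexity (w₁ • c₁ + w₂ • c₂) ≤ complexity g ∧
      w₁ • c₁ + w₂ • c₂ ≠ 0 ∧ (w₁ • c₁ + w₂ • c₂).totalDegree ≤ g.totalDegree ∧
      PerDvd n (w₁ • c₁ + w₂ • c₂) ∧ ¬ PerDvd n c₁ ∧ ¬ PerDvd n c₂

/-- The POSITIVIZER CONE of a (possibly signed) real polynomial `q`: nonnegative `p` with `p·q`
coefficientwise nonnegative.  If `A = per·q` is a monotone-cheap element of `(per)` then
`per·(q·p) = A·p` is cheap for every cheap `p ∈ P(q)`, and `q·p ≥ 0`: the crux's `h'` is `q·p`. -/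
def PositivizerCone {σ : Type*} (q : MvPolynomial σ ℝ) : Set (MvPolynomial σ ℝ≥0) :=
  {p | ∀ m, 0 ≤ coeff m (toR p * q)}

/-- `per_n` itself always positivizes its own signed cofactors: if `per·q = toR A ≥ 0` then
`toR (per over ℝ≥0) * q = toR A`. (Trivial; recorded because it is the canonical, EXPENSIVE witness.) -/
theorem per_mem_positivizerCone (n : ℕ) (A : MvPolynomial (Fin n × Fin n) ℝ≥0)
    (q : MvPolynomial (Fin n × Fin n) ℝ) (hA : toR A = perPoly (Fin n) ℝ * q) :
    perPoly (Fin n) ℝ≥0 ∈ PositivizerCone q := by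
  intro m
  have hmap : toR (perPoly (Fin n) ℝ≥0) = perPoly (Fin n) ℝ := by
    simp [toR, map_perPoly]
  rw [hmap, ← hA]
  simp [toR, coeff_map]

/-- **AUTOMATIC POSITIVITY up to degree `n + 1` (paper-proved this session, sharp; Lean size M):**
if `per_n · q` has nonnegative coefficients and `deg q ≤ n + 1`, then `q` has nonnegative coefficients.
Proof: for an exponent `γ` with `|supp γ| ≤ n + 1` order the rows by decreasing `γ`-degree; the partial
sums of the smallest `k` row-degrees are `≤ k`, so Hall gives a bijection `π : cols → rows` with
`π(j) ≥ max {i : (i,j) ∈ supp γ}`; for `ρ := π⁻¹` the digraph `i → ρ⁻¹(j)` (`(i,j) ∈ supp γ`) is acyclic,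
i.e. `μ_ρ` is the UNIQUE perfect matching of `μ_ρ ∪ supp γ`, hence `(per·q)_{μ_ρ+γ} = q_γ ≥ 0`.
SHARP: at degree `n + 2` the set `μ_σ ∪ μ_τ` (`σ⁻¹τ` a transposition) contains two matchings and signed
cofactors exist — `d*(2)=4` (`q = a² − ab + b²`), `d*(3)=5`, `d*(4)=6` by LP (kit j015655, j015673). -/
def AutomaticPositivity : Prop :=
  ∀ (n : ℕ) (q : MvPolynomial (Fin n × Fin n) ℝ), q.totalDegree ≤ n + 1 →
    (∀ m, 0 ≤ coeff m (perPoly (Fin n) ℝ * q)) → ∀ m, 0 ≤ coeff m q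

/-- **K2 = CHEAP LOW-DEGREE POSITIVIZATION (open; the second half of the card's decomposition
`C′ ⇐ K1 ∧ K2`):** a monotone-cheap `A = per_n·q` with `q` possibly signed admits a cheap nonnegative
positivizer `p` of quasi-polynomial degree; then `h' := q·p` is the crux's witness
(`per·h' = A·p`, `L ≤ L(A) + L(p) + 1`). -/
def CheapPositivization : Prop :=
  ∃ k : ℕ, ∀ (n : ℕ) (A : MvPolynomial (Fin n × Fin n) ℝ≥0) (q : MvPolynomial (Fin n × Fin n) ℝ),
    A ≠ 0 → toR A = perPoly (Fin n) ℝ * q →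
    ∃ p : MvPolynomial (Fin n × Fin n) ℝ≥0, p ≠ 0 ∧ p ∈ PositivizerCone q ∧
      p.totalDegree ≤ 2 ^ ((Nat.log 2 n + Nat.log 2 (complexity A) + Nat.log 2 A.totalDegree + k) ^ k) ∧
      complexity p ≤ 2 ^ ((Nat.log 2 n + Nat.log 2 (complexity A) + Nat.log 2 A.totalDegree + k) ^ k)

/-- **K1 = CREATION DEGREE (open; first half):** in the doubtful regime the prime walk can be made to
end at quasi-polynomial cofactor degree: every nonzero cheap `g ∈ (per_n)` (cofactor nonnegative) yields
a cheap `A ∈ (per_n)` (cofactor possibly SIGNED) of quasi-polynomial degree. -/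
def CreationDegree : Prop :=
  ∃ k : ℕ, ∀ (n : ℕ) (g : MvPolynomial (Fin n × Fin n) ℝ≥0), g ≠ 0 → PerDvdPos n g →
    ∃ A : MvPolynomial (Fin n × Fin n) ℝ≥0, A ≠ 0 ∧ PerDvd n A ∧
      A.totalDegree ≤ 2 ^ ((Nat.log 2 n + Nat.log 2 (complexity g) + k) ^ k) ∧
      complexity A ≤ 2 ^ ((Nat.log 2 n + Nat.log 2 (complexity g) + k) ^ k)

/-- **The permanent is NOT prime in the semiring `ℝ≥0[x]` (n = 2 witness, checked by `ring`):**
with `a = x₀₀x₁₁`, `b = x₀₁x₁₀`, `per₂ = a + b`,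
`(a³ + b³)·(a² + ab + b²) = per₂ · (a⁴ + a²b² + b⁴)` — the product of two nonnegative polynomials is a
NONNEGATIVE multiple of `per₂` although `a³ + b³ = per₂·(a² − ab + b²)` has a SIGNED cofactor and
`per₂ ∤ a² + ab + b²` at all.  So product gates CAN create nonnegative per-divisibility (positivization),
and the walk must be run over `ℝ`, not over `ℝ≥0`. -/
theorem per2_not_semiring_prime_witness :
    let a : MvPolynomial (Fin 2 × Fin 2) ℝ≥0 := X (0, 0) * X (1, 1)
    let b : MvPolynomial (Fin 2 × Fin 2) ℝ≥0 := X (0, 1) * X (1, 0)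
    (a ^ 3 + b ^ 3) * (a ^ 2 + a * b + b ^ 2) = (a + b) * (a ^ 4 + a ^ 2 * b ^ 2 + b ^ 4) := by
  intro a b
  ring

/-- … and `a + b` is literally `per₂` over `ℝ≥0` (tree lemma `permanent_fin_two`). -/
theorem per2_eq : perPoly (Fin 2) ℝ≥0 =
    X ((0 : Fin 2), (0 : Fin 2)) * X ((1 : Fin 2), (1 : Fin 2)) +
      X ((1 : Fin 2), (0 : Fin 2)) * X ((0 : Fin 2), (1 : Fin 2)) := by
  rw [perPoly, permanent_fin_two]
  simp [Matrix.mvPolynomialX_apply]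

/-! ## Card `abc-tower-collapse` -/

/-- **First lemma (TWO-TOWER COLLAPSE; provable now from the tree's UFD theorem
`Summit.ValiantsHypothesis.Theorems.permQuot_isDomain_and_ufm`, size M–L):** in the graded UFD
`S_n = ℂ[x]/(per_n)` (`n ≥ 3`) prime factors of homogeneous elements are homogeneous of degree `≥ 1`,
so `v_π(V̄) ≤ deg V` for every prime `π`; from `V̄₁ ū^N = −V̄₂ ū'^N` with `N > deg Vᵢ` all valuations of
`ū, ū'` agree, `ū = c·ū'` with `c ∈ ℝ*` (units of `S_n` are scalars; `c` real by conjugation), and then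
`(c^N V̄₁ + V̄₂) ū'^N = 0` in a domain.  OUTPUT: a cheap NONNEGATIVE element of `(per_n)` of LOW degree
among `u`, `u'`, `|c|^N V₁ + V₂` (if `c^N > 0`), `u + |c| u'` (if `c^N < 0`). -/
def TwoTowerCollapse : Prop :=
  ∀ (n N : ℕ) (V₁ V₂ u u' : MvPolynomial (Fin n × Fin n) ℝ≥0),
    3 ≤ n → V₁ ≠ 0 → V₂ ≠ 0 →
    V₁.IsHomogeneous V₁.totalDegree → V₂.IsHomogeneous V₂.totalDegree →
    u.IsHomogeneous u.totalDegree → u'.IsHomogeneous u'.totalDegree →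
    V₁.totalDegree < N → V₂.totalDegree < N →
    PerDvd n (V₁ * u ^ N + V₂ * u' ^ N) →
      PerDvd n u ∨ PerDvd n u' ∨
      (∃ c : ℝ≥0, 0 < c ∧ PerDvd n (c • V₁ + V₂)) ∨
      (∃ c : ℝ≥0, 0 < c ∧ PerDvd n (u + c • u'))

/-- **SINGLE-BASE TOWER COLLAPSE (paper-provable via Brownawell–Masser 1986 on a generic curve
section of `Z(per_n)`, irreducible by Kaltofen's effective Hilbert irreducibility; Lean XL):** a
positive relation `∑ⱼ zⱼ · t^{eⱼ} ∈ (per_n)` with low-degree nonnegative `zⱼ`, one tower base `t ∉ (per_n)`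
and ARBITRARY exponents collapses: some nonempty sub-family, with its exponents shifted down to a window
of polynomial width, is again a (cheap, nonnegative, now LOW-degree) element of `(per_n)`.  This is the
repeated-squaring enemy `h = u^{2^j}·v` of the crux's why-might-fail, for Π-tower circuits. -/
def SingleBaseTowerCollapse : Prop :=
  ∃ κ : ℕ, ∀ (n m T : ℕ) (z : Fin m → MvPolynomial (Fin n × Fin n) ℝ≥0)
    (t : MvPolynomial (Fin n × Fin n) ℝ≥0) (e : Fin m → ℕ),
    3 ≤ n → 0 < m → t ≠ 0 → ¬ PerDvd n t → t.IsHomogeneous t.totalDegree → t.totalDegree ≤ T →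
    (∀ j, z j ≠ 0 ∧ (z j).IsHomogeneous (z j).totalDegree ∧ (z j).totalDegree ≤ T) →
    (∀ j j', (z j).totalDegree + e j * t.totalDegree = (z j').totalDegree + e j' * t.totalDegree) →
    PerDvd n (∑ j, z j * t ^ e j) →
      ∃ (J : Finset (Fin m)) (e₀ : ℕ), J.Nonempty ∧ (∀ j ∈ J, e₀ ≤ e j ∧ e j ≤ e₀ + (n + m + T) ^ κ) ∧
        PerDvd n (∑ j ∈ J, z j * t ^ (e j - e₀))

end Summit.ValiantsHypothesis.ValiantsHypothesis.Cruxes.PerCofactorDegreeReduction.Ideator2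

end
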